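import Summits.AtomisticToContinuum.BoseEinsteinCondensation.Theses.BECJelliumDischarge
import Literature.MathematicalPhysics.QuantumManyBody.JelliumBoseGas
import Literature.MathematicalPhysics.QuantumManyBody.BoseGasThermodynamicLimitRuelle
import HarnessLib

/-!
# Strategist sketch — crux `ChargedGasBEC` (stmt-AtomisticToContinuum-13668), census companion

Typed companions of `STRATEGY-CENSUS.md` (crux-strategist cstrat-…-13668-s1, 2026-08-17):

* `CompleteChargedCondensation` — the strengthening S⁺1 (`λ_max ≥ (1 − C√κ)N`), with the one-line
  `completeChargedCondensation_imp` to the vocabulary form of the crux;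
* `birthPhaseLocking_of_crux` — PROVED: the live line's hard stub `stub_phaseLocking` (birth) is a
  CONSEQUENCE of the crux (unpack `⨆_δ ⨅_Ψ`), i.e. given the provable `stub_localCondensation` it is
  crux-equivalent — the census's diagnosis of `birth`, kernel-checked.
-/

noncomputable section

namespace Summit.AtomisticToContinuum.BoseEinsteinCondensation.Cruxes.ChargedGasBEC.Strategist

open MeasureTheory ENNReal Filter
open Literature.MathematicalPhysics.QuantumManyBody.BoseGas
open Literature.MathematicalPhysics.QuantumManyBody.JelliumBoseGas
open Summit.AtomisticToContinuum.BoseEinsteinCondensation.Theses.BECJelliumDischarge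

/-- The vocabulary form of the crux (the route item unfolds to it by `rfl`). -/
def CruxVocab : Prop :=
  ∀ v : ℝ → ℝ≥0∞, IsRepulsiveFiniteRange v →
    ∃ κ₀ : ℝ, 0 < κ₀ ∧ ∀ κ : ℝ, 0 < κ → κ < κ₀ → ∃ ρ₀ : ℝ, 0 < ρ₀ ∧ ∀ ρ : ℝ, 0 < ρ → ρ < ρ₀ →
      ∃ c : ℝ, 0 < c ∧ ∀ᶠ N : ℕ in atTop,
        ENNReal.ofReal (c * N) ≤ chargedCondensateNumber v (κ * ρ ^ (1 / 3 : ℝ)) ρ N (sideLength ρ N)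

theorem cruxVocab_iff : CruxVocab ↔ ChargedGasBEC := Iff.rfl

/-- **S⁺1 — complete condensation of the charged gas at weak coupling**: depletion `≤ C√κ·N`
(what line `plasmon-gap-removal` delivers with Onsager-scale input; Foldy-scale input would give
`Cκ^{3/4}`). -/
def CompleteChargedCondensation : Prop :=
  ∀ v : ℝ → ℝ≥0∞, IsRepulsiveFiniteRange v →
    ∃ C : ℝ, 0 ≤ C ∧ ∃ κ₀ : ℝ, 0 < κ₀ ∧ ∀ κ : ℝ, 0 < κ → κ < κ₀ → ∃ ρ₀ : ℝ, 0 < ρ₀ ∧ ∀ ρ : ℝ, 0 < ρ → ρ < ρ₀ →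
      ∀ᶠ N : ℕ in atTop,
        ENNReal.ofReal ((1 - C * Real.sqrt κ) * N) ≤
          chargedCondensateNumber v (κ * ρ ^ (1 / 3 : ℝ)) ρ N (sideLength ρ N)

/-- S⁺1 implies the crux (shrink `κ₀` so that `1 − C√κ ≥ 1/2`). -/
theorem completeChargedCondensation_imp : CompleteChargedCondensation → CruxVocab := by
  intro h v hv
  obtain ⟨C, hC, κ₀, hκ₀, h⟩ := h v hv
  have hκ₁ : 0 < (1 / (2 * (C + 1))) ^ 2 := by positivity
  refine ⟨min κ₀ ((1 / (2 * (C + 1))) ^ 2), lt_min hκ₀ hκ₁, fun κ hκ hκlt => ?_⟩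
  obtain ⟨ρ₀, hρ₀, h⟩ := h κ hκ (lt_of_lt_of_le hκlt (min_le_left _ _))
  refine ⟨ρ₀, hρ₀, fun ρ hρ hρlt => ⟨1 / 2, by norm_num, ?_⟩⟩
  filter_upwards [h ρ hρ hρlt] with N hN
  refine le_trans (ENNReal.ofReal_le_ofReal ?_) hN
  have hs : Real.sqrt κ < 1 / (2 * (C + 1)) := by
    calc Real.sqrt κ < Real.sqrt ((1 / (2 * (C + 1))) ^ 2) :=
          Real.sqrt_lt_sqrt hκ.le (lt_of_lt_of_le hκlt (min_le_right _ _))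
      _ = 1 / (2 * (C + 1)) := Real.sqrt_sq (by positivity)
  have h1 : C * Real.sqrt κ ≤ 1 / 2 := by
    have h2 : C * Real.sqrt κ ≤ C * (1 / (2 * (C + 1))) :=
      mul_le_mul_of_nonneg_left hs.le hC
    have h3 : C * (1 / (2 * (C + 1))) ≤ 1 / 2 := by
      rw [mul_one_div, div_le_div_iff₀ (by positivity) (by norm_num)]
      nlinarith
    exact h2.trans h3
  have hN0 : (0 : ℝ) ≤ N := N.cast_nonneg
  nlinarith

/-- **Diagnosis of the live line `birth`, kernel-checked**: its hard stub `stub_phaseLocking` is implied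
by the crux outright (for ANY deficiency `ε`, scale `K`: the local-condensation hypothesis is not even
used), by unpacking `ofReal (cN) ≤ ⨆_δ ⨅_Ψ maxOccupation` at level `c/2`. Hence, modulo the provable
`stub_localCondensation`, `stub_phaseLocking` is crux-EQUIVALENT: the birth line isolates the open content
but transfers none of it. (Statement copied verbatim from `Lines/birth.lean`.) -/
theorem birthPhaseLocking_of_crux (hX : CruxVocab) :
    ∀ v : ℝ → ℝ≥0∞, IsRepulsiveFiniteRange v → ∃ ε : ℝ, 0 < ε ∧ ∃ K : ℝ, 0 < K ∧
      ∃ κ₀ : ℝ, 0 < κ₀ ∧ ∀ κ : ℝ, 0 < κ → κ < κ₀ → ∃ ρ₀ : ℝ, 0 < ρ₀ ∧ ∀ ρ : ℝ, 0 < ρ → ρ < ρ₀ →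
        ∃ c : ℝ, 0 < c ∧ ∀ᶠ N : ℕ in atTop, ∃ δ : ℝ≥0∞, 0 < δ ∧ ∀ M : ℕ, 0 < M →
          K * ρ ^ (-(1 / 3 : ℝ)) ≤ sideLength ρ N / M →
          sideLength ρ N / M ≤ 2 * K * ρ ^ (-(1 / 3 : ℝ)) →
          ∀ Ψ : TrialState N (sideLength ρ N),
            chargedEnergy v (κ * ρ ^ (1 / 3 : ℝ)) ρ Ψ ≤
                chargedGroundStateEnergy v (κ * ρ ^ (1 / 3 : ℝ)) ρ N (sideLength ρ N) + δ →
            ENNReal.ofReal ((1 - ε) * N) ≤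
                ∑ k : Fin 3 → Fin M, occupation N
                  ((subBox (sideLength ρ N / M) (sideLength ρ N / M) (fun j => (k j : ℕ))).indicator
                    fun _ => ((Real.sqrt ((sideLength ρ N / M) ^ 3))⁻¹ : ℂ)) Ψ.ψ →
              ENNReal.ofReal (c * N) ≤ maxOccupation N Ψ.ψ := by
  intro v hv
  obtain ⟨κ₀, hκ₀, hX⟩ := hX v hv
  refine ⟨1, one_pos, 1, one_pos, κ₀, hκ₀, fun κ hκ hκlt => ?_⟩
  obtain ⟨ρ₀, hρ₀, hX⟩ := hX κ hκ hκlt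
  refine ⟨ρ₀, hρ₀, fun ρ hρ hρlt => ?_⟩
  obtain ⟨c, hc, hX⟩ := hX ρ hρ hρlt
  refine ⟨c / 2, by positivity, ?_⟩
  filter_upwards [hX, eventually_gt_atTop 0] with N hN hNpos
  -- unpack the `⨆ δ > 0` at the level `ofReal (c/2 · N) < ofReal (c · N)`
  have hlt : ENNReal.ofReal (c / 2 * N) < ENNReal.ofReal (c * N) := by
    rw [ENNReal.ofReal_lt_ofReal_iff (by positivity)]
    have : (0 : ℝ) < N := by exact_mod_cast hNpos
    nlinarith
  have hlt' := lt_of_lt_of_le hlt hN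
  unfold chargedCondensateNumber at hlt'
  rw [lt_iSup_iff] at hlt'
  obtain ⟨δ, hδ⟩ := hlt'
  rw [lt_iSup_iff] at hδ
  obtain ⟨hδpos, hδ⟩ := hδ
  refine ⟨δ, hδpos, fun M _ _ _ Ψ hΨ _ => ?_⟩
  exact hδ.le.trans (iInf₂_le Ψ hΨ)

end Summit.AtomisticToContinuum.BoseEinsteinCondensation.Cruxes.ChargedGasBEC.Strategist

end
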